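import Summits.ResolutionOfSingularities.ResolutionOfSingularities.Theorems.WeightedInvariantIota3SigmaStarBaseChange
import Summits.ResolutionOfSingularities.ResolutionOfSingularities.Theorems.WeightedInvariantIota3SigmaDescentSX
import HarnessLib

/-!
# DOMINATED DESCENT OF REACHED WEIGHTS ALONG `S → S(X)` FOR A FINITE RESIDUE FIELD, modulo (J-can)+(EX) at a Galois base change
# (res-type-057's (D-c), completed through res-L1-w43-stub-3's Galois route; door `HypersurfaceCentreConstruction`,
# stmt-ResolutionOfSingularities-19897; P3 rung (c11σ) for the torus translate at points with finite residue field; hand res-L1-w43-stub-3)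

Topic: `Summits/ResolutionOfSingularities/ResolutionOfSingularities/Theorems`. Helper for the door item
`HypersurfaceCentreConstruction` (stmt-ResolutionOfSingularities-19897, route `WeightedInvariant`), line `local-engine` (L W4.3),
def-free.

**What is proved** (`flagReaches_dominated_of_genericFibre_finite`).  `S` local of characteristic `p` with FINITE residue field
`κ`, `f ∈ S`, `ν = ord f`.  If an admissible `(q; r₁, r₂)` is reached by `C f` in the generic fibre ring
`S(X) = S[X]_{𝔪S[X]}`, then — GRANTED (J-can) and (EX) (SPEC (Δ12) texts) at `(S ⊗_{𝔽_p} 𝔽_{p^n}, f ⊗ 1)` for every `n` prime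
to `[κ:𝔽_p]` — some admissible `(q'; r₁', r₂')` lexicographically `≥ (q; r₁, r₂)` (ratio first, level second) is reached by `f` in
`S` itself.  (Plain reach descent is FALSE for finite `κ` along finite étale maps — memo O53-DESC-CEX — so «dominated» is the right
shape; it is what the σ-letters need.)

**Proof.** 057's good-point criterion (p536350) presents the flag by `G₁, G₂ ∈ 𝔪S[X]`, `s ∉ 𝔪S[X]` with `s·C f` in the explicit
`S[X]`-ideal and the polynomial flag condition (★) (p542470).  Choose a prime `n > max([κ:𝔽_p], deg G₁ + deg G₂ + deg s)`;
`S_n := S ⊗_{𝔽_p} 𝔽_{p^n}` is local with `𝔪S_n = 𝔪_n` (p576792) and residue field of size `≥ p^n > n`.  (★) base-changes to `S_n`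
(p-StarBaseChange `star_baseChange`, via the `S`-linear trace datum), so the base-changed flag SPECIALISES at some `a ∈ S_n` with
`s(a)` a unit (`isTwoFlag_specialises_of_card_of_star`); the ideal identity maps to `S_n[X]` and evaluates at `a`
(`map_flagIdeal_aeval_le`), whence `FlagReaches (f ⊗ 1) ν q r₁ r₂` in `S_n`.  By (EX) at `S_n` a primitive σ-maximiser dominates it,
and by GALOIS DESCENT OF MAXIMISERS (p574497 `SigmaGaloisDescent.exists_isSigmaMaximiser_of_galois`, using (J-can) at `S_n`) that
maximiser's triple is reached in `S`.

[OURS · L1 W4.3 · (o53-desc′) finite residue field]  Replaces the role of NO printed item; NOT a statement of the manuscript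
[claim: Hironaka2017, status: under-review]. AI work, weaker than expert review.  No named facts ((J-can)/(EX) are binders).

## References

* H. Hironaka, *Characteristic polyhedra of singularities*, J. Math. Kyoto Univ. 7 (1967), §3. [Hironaka1967]
* A. Grothendieck, *EGA IV*, Publ. Math. IHÉS 20 (1964), 0_IV (19.7.1). [EGA0IV]
-/

noncomputable section

open IsLocalRing Polynomial Module Literature.AlgebraicGeometry.Resolution
open Summit.ResolutionOfSingularities.ResolutionOfSingularities.Cruxes.HypersurfaceCentreConstruction.LocalEngine
open Summit.ResolutionOfSingularities.ResolutionOfSingularities.Cruxes.HypersurfaceCentreConstruction.LocalEngine.Iota3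
open scoped TensorProduct

set_option linter.dupNamespace false -- mandated namespace of this single-conjunct summit

namespace Summit.ResolutionOfSingularities.ResolutionOfSingularities.Theorems

namespace GenericFibreFinite

/-! ## §1 The explicit `S[X]`-ideal maps along a base change `S → S'` with `𝔪S' ⊆ 𝔪'` -/

section MapIdeal

variable {S S' : Type} [CommRing S] [CommRing S'] [IsLocalRing S] [IsLocalRing S'] [Algebra S S']

/-- `𝔪S[X]` maps into `𝔪'S'[X]` under `φ[X]` when `𝔪S' ≤ 𝔪'`. [folklore] -/
theorem map_mapRingHom_map_C_le (h𝔪 : (maximalIdeal S).map (algebraMap S S') ≤ maximalIdeal S') :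
    ((maximalIdeal S).map (C : S →+* S[X])).map (mapRingHom (algebraMap S S')) ≤
      (maximalIdeal S').map (C : S' →+* S'[X]) := by
  have hc : (mapRingHom (algebraMap S S')).comp C = C.comp (algebraMap S S') := RingHom.ext fun x => by simp
  rw [Ideal.map_map, hc, ← Ideal.map_map]
  exact Ideal.map_mono h𝔪

/-- The explicit flag ideal of `S[X]` maps into that of `S'[X]` for the base-changed polynomials. [folklore] -/
theorem map_flagIdeal_le (h𝔪 : (maximalIdeal S).map (algebraMap S S') ≤ maximalIdeal S') (G₁ G₂ : S[X]) (q r₁ r₂ n : ℕ) :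
    (⨆ α : ℕ, ⨆ β : ℕ, Ideal.span {G₁ ^ α * G₂ ^ β} *
        ((maximalIdeal S).map (C : S →+* S[X])) ^ ((n - r₁ * α - r₂ * β + q - 1) / q)).map (mapRingHom (algebraMap S S')) ≤
      ⨆ α : ℕ, ⨆ β : ℕ, Ideal.span {(G₁.map (algebraMap S S')) ^ α * (G₂.map (algebraMap S S')) ^ β} *
        ((maximalIdeal S').map (C : S' →+* S'[X])) ^ ((n - r₁ * α - r₂ * β + q - 1) / q) := by
  rw [Ideal.map_iSup]
  refine iSup_mono fun α => ?_
  rw [Ideal.map_iSup]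
  refine iSup_mono fun β => ?_
  rw [Ideal.map_mul, Ideal.map_pow, Ideal.map_span, Set.image_singleton, map_mul, map_pow, map_pow, coe_mapRingHom]
  exact Ideal.mul_mono_right (Ideal.pow_right_mono (map_mapRingHom_map_C_le h𝔪) _)

end MapIdeal

/-! ## §2 The residue field of the Galois base change is large -/

section Card

variable (p : ℕ) [Fact p.Prime] (S : Type) [CommRing S] [IsLocalRing S] [Algebra (ZMod p) S]

/-- Under (H), `Nat.card (κ(S ⊗ 𝔽_{p^n})) ≥ p^n` and the residue field is finite (it contains a copy of `𝔽_{p^n}` and is the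
finite algebra `κ_S ⊗ 𝔽_{p^n}`). [folklore] -/
theorem finite_and_card_residueField [Finite (ResidueField S)] (n : ℕ) (hn : n ≠ 0)
    (h : (finrank (ZMod p) (ResidueField S)).Coprime n) :
    letI := GaloisBaseChange.isLocalRing_of_isField_quotient (ZMod p) S (GaloisField p n)
      (GaloisBaseChange.isField_quotient_galoisField p S n hn h)
    Finite (ResidueField (S ⊗[ZMod p] GaloisField p n)) ∧ p ^ n ≤ Nat.card (ResidueField (S ⊗[ZMod p] GaloisField p n)) := by
  have hF := GaloisBaseChange.isField_quotient_galoisField p S n hn h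
  letI := GaloisBaseChange.isLocalRing_of_isField_quotient (ZMod p) S (GaloisField p n) hF
  -- the residue field is `(S ⊗ L) ⧸ 𝔪_S (S ⊗ L) ≃ κ ⊗ L`
  have hmax := GaloisBaseChange.map_maximalIdeal_eq (ZMod p) S (GaloisField p n) hF
  obtain ⟨e⟩ := GaloisBaseChange.nonempty_ringEquiv_quotient_tensor (ZMod p) S (GaloisField p n)
  let e' : ResidueField (S ⊗[ZMod p] GaloisField p n) ≃+* (ResidueField S ⊗[ZMod p] GaloisField p n) :=
    (Ideal.quotEquivOfEq hmax.symm).trans e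
  haveI : Finite (ResidueField S ⊗[ZMod p] GaloisField p n) := Module.finite_of_finite (ZMod p)
  haveI hfin : Finite (ResidueField (S ⊗[ZMod p] GaloisField p n)) := Finite.of_equiv _ e'.toEquiv.symm
  refine ⟨hfin, ?_⟩
  -- `𝔽_{p^n} → κ(S_n)` is injective (a ring map out of a field)
  have hinj : Function.Injective ((residue (S ⊗[ZMod p] GaloisField p n)).comp
      (Algebra.TensorProduct.includeRight (R := ZMod p) (A := S) (B := GaloisField p n)).toRingHom) :=
    RingHom.injective _
  rw [← GaloisField.card p n hn]
  exact Nat.card_le_card_of_injective _ hinj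

end Card

/-! ## §3 Dominated descent -/

section Main

variable (p : ℕ) [Fact p.Prime] {S : Type} [CommRing S] [IsLocalRing S] [Algebra (ZMod p) S] [Finite (ResidueField S)]

/-- **DOMINATED DESCENT OF REACHED WEIGHTS ALONG `S → S(X)`, FINITE RESIDUE FIELD**, modulo (J-can)+(EX) at the Galois base changes
`S ⊗_{𝔽_p} 𝔽_{p^n}` (`n` prime to `[κ:𝔽_p]`). [cite: Hironaka1967, §3] [cite: EGA0IV, 0_IV (19.7.1)]
[OURS · L1 W4.3 · (o53-desc′) finite residue field] -/
theorem flagReaches_dominated_of_genericFibre_finite {f : S} {q r₁ r₂ : ℕ}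
    (hadm : AdmissibleTriple q r₁ r₂)
    (h : FlagReaches (algebraMap S[X] (Localization.AtPrime ((maximalIdeal S).map (C : S →+* S[X]))) (C f))
      (adicOrder f).toNat q r₁ r₂)
    (hKEY : ∀ (n : ℕ) (hn : n ≠ 0) (hcop : (finrank (ZMod p) (ResidueField S)).Coprime n),
      letI := GaloisBaseChange.isLocalRing_of_isField_quotient (ZMod p) S (GaloisField p n)
        (GaloisBaseChange.isField_quotient_galoisField p S n hn hcop)
      (∀ (g₁ g₂ : S ⊗[ZMod p] GaloisField p n) (q r₁ r₂ : ℕ) (g₁' g₂' : S ⊗[ZMod p] GaloisField p n) (q' r₁' r₂' : ℕ),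
        IsSigmaMaximiser (algebraMap S _ f) (adicOrder (algebraMap S (S ⊗[ZMod p] GaloisField p n) f)).toNat g₁ g₂ q r₁ r₂ →
        IsPrimitiveTriple q r₁ r₂ →
        IsSigmaMaximiser (algebraMap S _ f) (adicOrder (algebraMap S (S ⊗[ZMod p] GaloisField p n) f)).toNat
          g₁' g₂' q' r₁' r₂' → IsPrimitiveTriple q' r₁' r₂' →
        ∀ m : ℕ, flagContactFiltration g₁' g₂' q' r₁' r₂' m = flagContactFiltration g₁ g₂ q r₁ r₂ m) ∧
      (∃ (g₁ g₂ : S ⊗[ZMod p] GaloisField p n) (q r₁ r₂ : ℕ),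
        IsSigmaMaximiser (algebraMap S _ f) (adicOrder (algebraMap S (S ⊗[ZMod p] GaloisField p n) f)).toNat g₁ g₂ q r₁ r₂ ∧
          IsPrimitiveTriple q r₁ r₂)) :
    ∃ q' r₁' r₂' : ℕ, AdmissibleTriple q' r₁' r₂' ∧
      (r₁ * r₂' < r₁' * r₂ ∨ (r₁ * r₂' = r₁' * r₂ ∧ r₁ * q' ≤ r₁' * q)) ∧ FlagReaches f (adicOrder f).toNat q' r₁' r₂' := by
  classical
  set ν := (adicOrder f).toNat with hν
  -- 057's presentation of the flag by polynomials, and the polynomial flag condition (★)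
  obtain ⟨G₁, G₂, s, hs, hflG, hsF, -⟩ := FlagReaches.exists_goodPoint_criterion h
  obtain ⟨hG₁, hG₂, hstar⟩ := isTwoFlag_genericFibre_polynomial hflG
  -- a prime `n` beyond `[κ:𝔽_p]` and the degree bound
  set m := finrank (ZMod p) (ResidueField S) with hm
  set D := G₁.natDegree + G₂.natDegree + s.natDegree with hD
  obtain ⟨n, hnge, hnprime⟩ := Nat.exists_infinite_primes (max m D + 1)
  have hn0 : n ≠ 0 := hnprime.ne_zero
  have hnm : m < n := by have := le_max_left m D; omega
  have hnD : D < n := by have := le_max_right m D; omega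
  have hcop : m.Coprime n := by
    rw [Nat.Coprime, Nat.gcd_comm]
    refine (Nat.coprime_or_dvd_of_prime hnprime m).resolve_right fun hdvd => ?_
    have hm0 : 0 < m := finrank_pos
    exact absurd (Nat.le_of_dvd hm0 hdvd) (not_le.mpr hnm)
  -- the base change `S_n`
  have hF := GaloisBaseChange.isField_quotient_galoisField p S n hn0 hcop
  letI := GaloisBaseChange.isLocalRing_of_isField_quotient (ZMod p) S (GaloisField p n) hF
  have h𝔪n := GaloisBaseChange.map_maximalIdeal_eq (ZMod p) S (GaloisField p n) hF
  obtain ⟨hfin, hcardn⟩ := finite_and_card_residueField p S n hn0 hcop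
  haveI := hfin
  obtain ⟨hcan, hex⟩ := hKEY n hn0 hcop
  obtain ⟨t, ι, _, b, c, htadd, ht0, htlin, ht, hdual⟩ :=
    StarBaseChange.exists_linear_traceDatum (ZMod p) S (GaloisField p n)
  set φ := algebraMap S (S ⊗[ZMod p] GaloisField p n) with hφ
  -- (★) and the memberships over `S_n`
  have hstar' := StarBaseChange.star_baseChange h𝔪n htadd ht0 htlin b c hdual hstar
  have hG₁' := StarBaseChange.map_mem_map_C h𝔪n hG₁
  have hG₂' := StarBaseChange.map_mem_map_C h𝔪n hG₂
  -- the bad residues: roots of `s̄`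
  have hs' : s.map φ ∉ (maximalIdeal (S ⊗[ZMod p] GaloisField p n)).map (C : _ →+* (S ⊗[ZMod p] GaloisField p n)[X]) := by
    intro hmem
    apply hs
    rw [Ideal.mem_map_C_iff] at hmem ⊢
    intro k
    have hk := hmem k
    rw [coeff_map, ← h𝔪n] at hk
    haveI : IsLocalHom φ := GaloisBaseChange.isLocalHom (ZMod p) S (GaloisField p n) hF
    exact (IsLocalRing.mem_maximalIdeal _).mpr fun hu =>
      (IsLocalRing.mem_maximalIdeal _).mp (h𝔪n ▸ hk) ((isUnit_map_iff φ _).mpr hu)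
  set B := ((s.map φ).map (residue (S ⊗[ZMod p] GaloisField p n))).roots.toFinset with hB
  have hcard : (G₁.map φ).natDegree + (G₂.map φ).natDegree + B.card <
      Nat.card (ResidueField (S ⊗[ZMod p] GaloisField p n)) := by
    have h1 := natDegree_map_le (f := φ) (p := G₁)
    have h2 := natDegree_map_le (f := φ) (p := G₂)
    have h3 : B.card ≤ s.natDegree :=
      (Multiset.toFinset_card_le _).trans ((Polynomial.card_roots' _).trans
        ((natDegree_map_le).trans natDegree_map_le))
    have h4 : n < p ^ n := Nat.lt_pow_self (Nat.Prime.one_lt Fact.out)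
    omega
  obtain ⟨a, haB, hfla⟩ := StarBaseChange.isTwoFlag_specialises_of_card_of_star _ _ hG₁' hG₂' hstar' B hcard
  -- `s(a)` is a unit
  have hsa : IsUnit (aeval a (s.map φ)) := by
    refine isUnit_aeval_of_eval_residue_ne_zero fun h0 => haB ?_
    rw [hB, Multiset.mem_toFinset, mem_roots (map_residue_ne_zero_of_not_mem hs')]
    exact h0
  -- the identity, mapped to `S_n[X]` and evaluated at `a`
  have hsF' : mapRingHom φ (s * C f) ∈ ⨆ α : ℕ, ⨆ β : ℕ, Ideal.span {(G₁.map φ) ^ α * (G₂.map φ) ^ β} *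
      ((maximalIdeal (S ⊗[ZMod p] GaloisField p n)).map (C : _ →+* (S ⊗[ZMod p] GaloisField p n)[X])) ^
        ((r₁ * ν - r₁ * α - r₂ * β + q - 1) / q) :=
    map_flagIdeal_le h𝔪n.le G₁ G₂ q r₁ r₂ (r₁ * ν) (Ideal.mem_map_of_mem _ hsF)
  have hreach' : FlagReaches (φ f) ν q r₁ r₂ := by
    refine ⟨_, _, hfla, ?_⟩
    have h1 := map_flagIdeal_aeval_le a (G₁.map φ) (G₂.map φ) q r₁ r₂ (r₁ * ν) (Ideal.mem_map_of_mem _ hsF')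
    rw [coe_mapRingHom, Polynomial.map_mul, Polynomial.map_C, map_mul, AlgHom.toRingHom_eq_coe, AlgHom.coe_toRingHom,
      aeval_C, Algebra.algebraMap_self_apply] at h1
    exact (Ideal.unit_mul_mem_iff_mem _ hsa).mp h1
  -- (EX) at `S_n`: a primitive maximiser dominates; it descends by Galois descent
  obtain ⟨M₁, M₂, Q, R₁, R₂, hmaxU, hprimU⟩ := hex
  have hνn : (adicOrder (φ f)).toNat = ν := by rw [hν, hφ, adicOrder_algebraMap_eq_of_flat h𝔪n]
  have hreach'' : FlagReaches (φ f) (adicOrder (φ f)).toNat q r₁ r₂ := by rw [hνn]; exact hreach'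
  have hlex := hmaxU.2.2.2 q r₁ r₂ hadm hreach''
  obtain ⟨g₁, g₂, hmaxD, -⟩ := SigmaGaloisDescent.exists_isSigmaMaximiser_of_galois h𝔪n
    (fun g : GaloisField p n ≃ₐ[ZMod p] GaloisField p n => Algebra.TensorProduct.congr (AlgEquiv.refl : S ≃ₐ[S] S) g) t
    (fun y => by rw [ht y]; rfl) b c hdual hcan hmaxU hprimU
  refine ⟨Q, R₁, R₂, hmaxU.1, hlex, ?_⟩
  have hD := hmaxD.flagReaches
  rwa [hνn] at hD

end Main

end GenericFibreFinite

end Summit.ResolutionOfSingularities.ResolutionOfSingularities.Theorems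

end
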